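import Literature.MathematicalPhysics.QuantumFieldTheory.Balaban1983to89.B2Eq245Assembled
import Literature.MathematicalPhysics.QuantumFieldTheory.Balaban1983to89.B2Eq245Theta

/-!
# `Balaban1983to89.B2Eq245KernelField` — T. Bałaban, *(Higgs)₂,₃ quantum fields in a finite volume. II. An upper bound*,
Commun. Math. Phys. **86** (1982) 555–594 [Balaban1982Higgs2] p. 567: the kernel field of (2.45)/(2.46), *"Ã = (1 − θ_k)θ_{k−1}A^{(k−1),ε}
+ θ_kA^{(k),ε}"*, on the concrete carrier, and THE INSTANCE of the agreement hypothesis `Data245.Hyp.atil` of `B2Eq245Assembled` /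
`hAk` of `B2Eq246MaskedStep`: with print's cut-offs — *"The function θ_k is defined on T_η, is equal to 1 on B^{k−1}(Λ₂^{(k−1)})"* —
`Ã = A^{(k),ε}` on every bond whose source lies under `Λ₅^{(k−1)} ⊂ Λ₂^{(k−1)}`; for the CONSTRUCTED cut-offs `B2Eq245Theta.thetaOf`
(p23) this is `thetaOf_eq_one_of_mem`

statement-level skeleton of published theorems with citation tags; proofs where landed; nothing here is a claim about the Yang–Mills mass gap

CITATION HEADER (lean-in-tree rule).  lit-balaban typed skeleton (HOME `run/shared/lean/pub/lit-balaban/`), reader/typer and fold-owner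
line r02 (unit `lit-balaban-r02`, gen 52); SKELETON row **B2.Eq2.44** ((2.44)–(2.52)), sequel of the members `B2Eq246MaskedStep` (the
masked conditional step, hypothesis `hAk`) and `B2Eq245Assembled` ((2.45)/(2.46) AS DISPLAYED, hypothesis `Data245.Hyp.atil`), discharging
the item *"hAk from θ_k = 1 on B^{k−1}(Λ₂^{(k−1)}) ⊇ B^{k−1}(Λ₅^{(k−1)})"* of their HONEST SCOPE.  NOTHING restated: `Ã` IS r14's
`B2Sect2BDensities.aTilde245` taken bondwise with the cut-offs evaluated at the source of the bond (the convention of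
`B2Eq253StepIntegral.thetaMul`), the cut-offs ARE p23's `B2Eq245Theta.thetaOf` with `thetaOf_eq_one_of_mem`, the regions the typer's
`B2Eq243RegionsTower.towerRegion`.  Source text p. 567 [PDF 13]: *"where Ã = (1 − θ_k)θ_{k−1}A^{(k−1),ε} + θ_kA^{(k),ε}"*; p. 566–567:
*"The function θ_k is defined on T_η, is equal to 1 on B^{k−1}(Λ₂^{(k−1)}) and varies “smoothly” from 1 to 0 on a slice of thickness < M
surrounding B^{k−1}(Λ₂^{(k−1)}). These functions are rescaled in (2.44)."*

WHAT IS PROVED (0 `sorry`, standard axioms; one definition WITH BODY + theorems).  `atilde` (Ã bondwise), `atilde_apply`,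
`atilde_eq_of_theta_eq_one` (θ_k = 1 at the source ⇒ Ã = A^{(k)} on the bond), **`atil_of_theta_eq_one`** (the hypothesis
`Data245.Hyp.atil`/`hAk` for `Ã` from `θ_k = 1` under `Λ′₅`), **`atil_thetaOf`** (the same for p23's CONSTRUCTED `thetaOf` whenever
`B(Λ′₅) ⊂ Λ₂^{(k−1)}` of the constructed tower — print's `Λ₅^{(k−1)} ⊂ Λ₂^{(k−1)}`).
HONEST SCOPE.  (a) The cut-offs are evaluated at the source of a bond (a bond field `θ·A` needs a convention; g51's `thetaMul` uses the
same); (b) only the agreement hypothesis is discharged here — the other fields of `Data245.Hyp` (nesting, locality, nonnegativity,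
measurability of ζχχρ′) concern data print constructs elsewhere; (c) nothing quantitative.  Value = the kernel-field hypothesis of the
(2.45) = (2.46) theorem tied to print's `θ_k = 1` sentence and to the constructed cut-offs; NOT summit progress.
-/

namespace Literature.MathematicalPhysics.QuantumFieldTheory.Balaban1983to89.B2Eq245KernelField

open HiggsLattice HiggsAveraging
open B2Eq243RegionsTower (towerRegion)
open B2Prop31MinimizerRegions (towerRad)
open B2Eq245Theta (thetaOf plateau mem_plateau thetaOf_eq_one_of_mem)

variable {P : HiggsLattice.Params}

/-- **`Ã = (1 − θ_k)θ_{k−1}A^{(k−1),ε} + θ_kA^{(k),ε}`** (p. 567) as a bond field on `T_η`: r14's `aTilde245` taken bondwise, the site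
cut-offs `θ_k`, `θ_{k−1}` evaluated at the source of the bond. [cite: Balaban1982Higgs2, (2.45) p.567] -/
noncomputable def atilde (θk θkm1 : HiggsLattice.Site P 0 → ℝ) (Akm1 Ak : HiggsLattice.VecField P 0) : HiggsLattice.VecField P 0 :=
  B2Sect2BDensities.aTilde245 (fun b : HiggsLattice.PBond P 0 => θk b.src) (fun b => θkm1 b.src) Akm1 Ak

/-- Unfolding: `Ã_b = (1 − θ_k(b₋))θ_{k−1}(b₋)·A^{(k−1)}_b + θ_k(b₋)·A^{(k)}_b`. [cite: Balaban1982Higgs2, (2.45) p.567] -/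
theorem atilde_apply (θk θkm1 : HiggsLattice.Site P 0 → ℝ) (Akm1 Ak : HiggsLattice.VecField P 0) (b : HiggsLattice.PBond P 0) :
    atilde θk θkm1 Akm1 Ak b = (1 - θk b.src) * θkm1 b.src * Akm1 b + θk b.src * Ak b := by
  simp [atilde, B2Sect2BDensities.aTilde245]

/-- **Where `θ_k = 1`, `Ã = A^{(k),ε}`** (at the source of the bond). [cite: Balaban1982Higgs2, (2.45) p.567] -/
theorem atilde_eq_of_theta_eq_one {θk : HiggsLattice.Site P 0 → ℝ} (θkm1 : HiggsLattice.Site P 0 → ℝ)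
    (Akm1 Ak : HiggsLattice.VecField P 0) {b : HiggsLattice.PBond P 0} (h : θk b.src = 1) :
    atilde θk θkm1 Akm1 Ak b = Ak b := by
  rw [atilde_apply, h]
  ring

/-- **THE AGREEMENT HYPOTHESIS (`Data245.Hyp.atil` / `hAk`) from «θ_k = 1 on B^{k−1}(Λ₂^{(k−1)})»**: if `θ_k(z) = 1` for every fine site
`z` under `Λ′₅` (block label `z_{j+1} ∈ Λ′₅`), then `Ã = A^{(k),ε}` on every bond whose source lies under `Λ′₅` — in particular on the
bonds inside the blocks `B^{j+1}(y)`, `y ∈ Λ′₅`. [cite: Balaban1982Higgs2, (2.45) p.567] -/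
theorem atil_of_theta_eq_one {j : ℕ} {L5 : Finset (HiggsLattice.Site P (j + 1))} {θk : HiggsLattice.Site P 0 → ℝ}
    (hθ : ∀ z : HiggsLattice.Site P 0, blockIter (j + 1) z ∈ L5 → θk z = 1) (θkm1 : HiggsLattice.Site P 0 → ℝ)
    (Akm1 Ak : HiggsLattice.VecField P 0) :
    ∀ b : HiggsLattice.PBond P 0, blockIter (j + 1) b.src ∈ L5 → blockIter (j + 1) b.tgt ∈ L5 →
      blockIter (j + 1) b.src = blockIter (j + 1) b.tgt → atilde θk θkm1 Akm1 Ak b = Ak b :=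
  fun b hsrc _ _ => atilde_eq_of_theta_eq_one θkm1 Akm1 Ak (hθ b.src hsrc)

/-- **THE INSTANCE FOR THE CONSTRUCTED CUT-OFFS** (p23's `B2Eq245Theta.thetaOf`: `θ_{j+1} = 1` on `B^j(Λ₂^{(j)})` of the constructed
tower, `thetaOf_eq_one_of_mem`): for `k = j + 1 ≤ K` and `B(Λ′₅) ⊂ Λ₂^{(j)}` (print: Λ₅^{(k−1)} ⊂ Λ₂^{(k−1)}), the kernel field
`Ã = (1 − θ_{j+1})θ_j A^{(k−1)} + θ_{j+1}A^{(k)}` satisfies the agreement hypothesis of `B2Eq245Assembled.display245_eq_display246` /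
`B2Eq246MaskedStep.rt_condStep_masked`. [cite: Balaban1982Higgs2, (2.45) p.567] -/
theorem atil_thetaOf (Q : B2.Params) (bad : (i : ℕ) → Set (HiggsLattice.Site P i)) {K j : ℕ} (hj : j + 1 ≤ K)
    {L5 : Finset (HiggsLattice.Site P (j + 1))} (hL5 : blockSet L5 ⊆ towerRegion bad (towerRad Q P) j 2)
    (Akm1 Ak : HiggsLattice.VecField P 0) :
    ∀ b : HiggsLattice.PBond P 0, blockIter (j + 1) b.src ∈ L5 → blockIter (j + 1) b.tgt ∈ L5 →
      blockIter (j + 1) b.src = blockIter (j + 1) b.tgt →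
        atilde (thetaOf Q P bad K (j + 1)) (thetaOf Q P bad K j) Akm1 Ak b = Ak b := by
  refine atil_of_theta_eq_one (fun z hz => thetaOf_eq_one_of_mem hj (mem_plateau.mpr (hL5 ?_))) _ Akm1 Ak
  exact (mem_blockSet L5 (blockIter j z)).mpr hz

end Literature.MathematicalPhysics.QuantumFieldTheory.Balaban1983to89.B2Eq245KernelField
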